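import Summits.NavierStokesRegularity.NavierStokesRegularity.Theorems.LerayQuarterDissipationFiniteDissipationLiouvilleApexPressure
import Summits.NavierStokesRegularity.NavierStokesRegularity.Theorems.LerayQuarterDissipationFiniteDissipationLiouvilleApexDecay
import Summits.NavierStokesRegularity.NavierStokesRegularity.Theses.LerayQuarterDissipation
import Literature.Analysis.FluidPDE.LocalLerayBackwardUniquenessAnyDatum
import Literature.Analysis.FluidPDE.AncientWeakL3BackwardLiouvilleAssembly
import Literature.Analysis.FluidPDE.BoundedMildWeakL3LocalEnergySolution
import Literature.Analysis.FluidPDE.SereginSverakPressureProofs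
import Literature.Analysis.FluidPDE.LocalEnergyTimeShift
import HarnessLib

/-!
# Crux `FiniteDissipationLiouville` (stmt-NavierStokesRegularity-22144): members of the
# finite-dissipation stratum are local Leray solutions THROUGH the apex; the FINAL-SLICE LEAF
# (file 3/3)

Theorems file of route `LerayQuarterDissipation` (lead prover g3; `--supports` the crux, both registered
stubs). Navier–Stokes regularity is NOT proved by anything here; no summit is.

**Main results.** Let `u` be a member of the stratum `𝒟`: a Type-I ancient mild field in the KNSS
gauge (`IsTypeIAncientMild C u`) with Leray's quarter-rate dissipation law
`∫ ‖∇u(s)‖² ≤ K/√(−s)`, `s < 0`.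

* `exists_isLocalLeraySolutionOn_shift` — **𝒟 ⊂ Lemarié-Rieusset's local Leray class through the
  singular time**: for every `T > 0` the shifted field `t ↦ u(t − T)` on `(0, T) × ℝ³` — whose final
  time `T` is the apex — is a local Leray solution (`IsLocalLeraySolutionOn T 1 (u(−T)) …`,
  Lemarié-Rieusset 2016 Def. 14.1 with the clauses of Kang–Miura–Tsai Def. 3.2) for the gauged
  Calderón–Zygmund pressure of `…ApexPressure`. This is the formal content of the route's slogan
  "energy methods are legal on 𝒟" — and it holds up to and including the blow-up time.
* `eq_zero_of_tendsto_finalSlice` — **THE FINAL-SLICE LEAF**: if the slices tend to `0` in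
  `𝒟'(ℝ³)` as `t → 0⁻` (`∫ ⟪u(t), φ⟫ → 0` for every test field `φ`), then `u ≡ 0` on `t < 0`
  (Lemarié-Rieusset 2016, Thm. 15.4 — backward uniqueness for local Leray solutions, the tree's
  PROVED `IsLocalLeraySolutionOn.ae_zero_of_final_vanishing_unit_anyDatum` — applied to the
  shifted field; continuity upgrades a.e. to everywhere).
* `notSingular_of_tendsto_finalSlice`, `exists_test_not_tendsto_of_singular` — the regularity form
  and the PORTRAIT ENTRY: **every singular member of 𝒟, DSS or wandering, leaves a nonzero
  distributional trace at the singular time.** For the past-DSS members this trace is the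
  homogeneous final datum of the lead-g2 residue (`…BlowdownLeaf`, `…MassLeaf`); for the
  past-wandering recurrent members of `stub_pastWanderingRecurrentLiouville` it is the first leaf
  beyond the `L³` / scaled-energy corners.
* `finiteDissipationLiouville_iff_nonzeroTrace` — bookkeeping: the crux is equivalent to its
  restriction to members with NONZERO final trace.

References: P. G. Lemarié-Rieusset, *The Navier–Stokes Problem in the 21st Century* (2016), Def. 14.1,
Thm. 15.4; L. Escauriaza, G. Seregin, V. Šverák, Russ. Math. Surveys 58 (2003), §5; D. Chae, J. Wolf,
arXiv:1610.09464, §2 Step 2; K. Kang, H. Miura, T.-P. Tsai, IMRN 2021, Def. 3.2.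
-/

noncomputable section

-- the summit and its single sub-problem share the name (CONVENTIONS §1), as in every Theorems file
set_option linter.dupNamespace false

namespace Summit.NavierStokesRegularity.NavierStokesRegularity.Theorems.FiniteDissipationLiouville.Birth.Apex

open MeasureTheory Set Filter Topology Metric Function TopologicalSpace
open Literature.Analysis Literature.Analysis.FluidPDE
open scoped ENNReal NNReal RealInnerProductSpace

variable {C K : ℝ} {u : ℝ → EuclideanSpace ℝ (Fin 3) → EuclideanSpace ℝ (Fin 3)}

/-! ### Time shift of box integrals -/

/-- `∫∫_{(0,T)×K} F(t − T, x) = ∫∫_{(−T,0)×K} F`. -/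
theorem setLIntegral_prod_shift (T : ℝ) (K' : Set (EuclideanSpace ℝ (Fin 3)))
    (F : ℝ × EuclideanSpace ℝ (Fin 3) → ℝ≥0∞) :
    ∫⁻ z in Ioo 0 T ×ˢ K', F (z.1 - T, z.2) = ∫⁻ z in Ioo (-T) 0 ×ˢ K', F z := by
  have h := setLIntegral_prod_timeShift (-T) (-T) 0 K' F
  simp only [sub_neg_eq_add, neg_add_cancel, zero_add, neg_add_eq_sub] at h
  exact h

/-! ### The shifted field is classical on `[0, T)` -/

/-- The shifted pair `(u(· − T), p(· − T))` is classical on `[0, T)` when `(u, p)` is classical on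
`(−∞, 0)`. -/
theorem isClassicalNSSolutionOn_shift {p : ℝ → EuclideanSpace ℝ (Fin 3) → ℝ}
    (hsol : IsClassicalNSSolutionOn (Iio 0) 1 0 u p) (T : ℝ) :
    IsClassicalNSSolutionOn (Ico 0 T) 1 0 (fun t => u (t - T)) (fun t => p (t - T)) := by
  have h := hsol.comp_add_right (-T)
  have hset : (fun t : ℝ => t + -T) ⁻¹' Iio 0 = Iio T := by
    ext t
    simp only [mem_preimage, mem_Iio]
    constructor <;> intro ht <;> linarith
  rw [hset] at h
  have hf : (fun t : ℝ => (0 : ℝ → EuclideanSpace ℝ (Fin 3) → EuclideanSpace ℝ (Fin 3)) (t + -T)) = 0 := by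
    funext t; rfl
  have hu' : (fun t : ℝ => u (t + -T)) = fun t => u (t - T) := by
    funext t; rw [← sub_eq_add_neg]
  have hp' : (fun t : ℝ => p (t + -T)) = fun t => p (t - T) := by
    funext t; rw [← sub_eq_add_neg]
  rw [hf, hu', hp'] at h
  exact h.mono Ico_subset_Iio_self (uniqueDiffOn_Ico 0 T)

/-! ### Members of the stratum are local Leray solutions through the apex -/

/-- **Members of the finite-dissipation stratum are local Leray solutions through the singular
time.** For `u ∈ 𝒟` and `T > 0`, the shifted field `t ↦ u(t − T)` is a local Leray solution on
`(0, T) × ℝ³` with datum `u(−T)` (Lemarié-Rieusset 2016, Def. 14.1; Kang–Miura–Tsai Def. 3.2), for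
the gauged Calderón–Zygmund pressure: suitability (classical on `[0, T)`), `u ∈ L²((0,T) × K)`,
`p ∈ L^{3/2}((0,T) × K)`, the `(L^∞_t L²_x)_{uloc}` and `(L²_t Ḣ¹_x)_{uloc}` classes, the datum in
`L²_loc`, and the decay (7) at spatial infinity — ALL THROUGH THE APEX `t = T` (files 1–2). -/
theorem exists_isLocalLeraySolutionOn_shift (hu : IsTypeIAncientMild C u)
    (hlaw : ∀ s : ℝ, s < 0 → ∫⁻ x, ‖fderiv ℝ (u s) x‖ₑ ^ 2 ≤ ENNReal.ofReal (K / Real.sqrt (-s)))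
    {T : ℝ} (hT : 0 < T) :
    ∃ π : ℝ → EuclideanSpace ℝ (Fin 3) → ℝ,
      IsLocalLeraySolutionOn T 1 (u (-T)) (fun t => u (t - T)) π := by
  obtain ⟨p, hsol, hpint⟩ := exists_normalised_pressure hu hlaw
  have hcl := isClassicalNSSolutionOn_shift hsol T
  have hslab : ((slab (EuclideanSpace ℝ (Fin 3)) (Ioo 0 T) isOpen_Ioo :
      Opens (ℝ × EuclideanSpace ℝ (Fin 3))) : Set (ℝ × EuclideanSpace ℝ (Fin 3))) =
      Ioo 0 T ×ˢ univ := rfl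
  refine ⟨fun t => p (t - T), ⟨?_, ?_, ?_, ?_, ?_, ?_, ?_⟩⟩
  · -- (1)+(4) suitability on the open slab
    exact SereginSverak2002.isSuitableWeakSolutionOn_of_classical hcl _ (by rw [hslab])
  · -- `u ∈ L²((0,T) × K)`
    intro K' hK'
    have e := setLIntegral_prod_shift T K' (fun w => ‖u w.1 w.2‖ₑ ^ 2)
    rw [show (∫⁻ z in Ioo 0 T ×ˢ K', ‖(fun t => u (t - T)) z.1 z.2‖ₑ ^ 2) =
        ∫⁻ z in Ioo 0 T ×ˢ K', (fun w : ℝ × EuclideanSpace ℝ (Fin 3) => ‖u w.1 w.2‖ₑ ^ 2) (z.1 - T, z.2)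
        from rfl, e]
    exact lintegral_slab_compact_sq_lt_top hu hlaw hT hK'
  · -- `π ∈ L^{3/2}((0,T) × K)`
    intro K' hK'
    obtain ⟨R, hR0, hR⟩ := hK'.isBounded.subset_ball_lt 0 (0 : EuclideanSpace ℝ (Fin 3))
    have e := setLIntegral_prod_shift T K' (fun w => ‖p w.1 w.2‖ₑ ^ (3 / 2 : ℝ))
    rw [show (∫⁻ z in Ioo 0 T ×ˢ K', ‖(fun t => p (t - T)) z.1 z.2‖ₑ ^ (3 / 2 : ℝ)) =
        ∫⁻ z in Ioo 0 T ×ˢ K', (fun w : ℝ × EuclideanSpace ℝ (Fin 3) =>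
          ‖p w.1 w.2‖ₑ ^ (3 / 2 : ℝ)) (z.1 - T, z.2) from rfl, e]
    exact lt_of_le_of_lt (lintegral_mono_set (Set.prod_mono Subset.rfl hR)) (hpint T R hT hR0)
  · -- `(L^∞_t L²_x)_{uloc}` through the apex
    intro R hR
    obtain ⟨M, hM⟩ := exists_ae_forall_lintegral_ball_sq_le hu hlaw hR hT
    refine ⟨M, ?_⟩
    have hM' : ∀ᵐ s ∂(volume : Measure ℝ), s ∈ Ioo (-T) 0 →
        ∀ x₀ : EuclideanSpace ℝ (Fin 3), ∫⁻ x in ball x₀ R, ‖u s x‖ₑ ^ 2 ≤ M :=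
      (ae_restrict_iff' measurableSet_Ioo).1 hM
    have hshift := (measurePreserving_sub_right (volume : Measure ℝ) T).quasiMeasurePreserving.ae hM'
    refine (ae_restrict_iff' measurableSet_Ioo).2 ?_
    filter_upwards [hshift] with t ht htI x₀
    exact ht ⟨by linarith [htI.1], by linarith [htI.2]⟩ x₀
  · -- `(L²_t Ḣ¹_x)_{uloc}`: the dissipation through the apex
    have hfin := lintegral_slab_frobenius_lt_top hu hlaw T
    have hu1 : ContDiffOn ℝ 1 (uncurry fun t => u (t - T)) (Ioo 0 T ×ˢ univ) :=
      (hcl.smooth_velocity.mono Ioo_subset_Ico_self).of_le (by norm_cast)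
    refine ⟨fun t x => fderiv ℝ (u (t - T)) x, ?_, fun R hR => ?_⟩
    · exact hasWeakSpatialGradientOn_of_contDiffOn isOpen_Ioo hslab.subset hu1
    · refine ⟨(∫⁻ z in Ioo (-T) 0 ×ˢ (univ : Set (EuclideanSpace ℝ (Fin 3))),
        ENNReal.ofReal (frobeniusNormSq (fderiv ℝ (u z.1) z.2))).toNNReal, fun x₀ => ?_⟩
      rw [ENNReal.coe_toNNReal hfin.ne]
      calc ∫⁻ z in Ioo 0 T ×ˢ ball x₀ R, ENNReal.ofReal (frobeniusNormSq (fderiv ℝ (u (z.1 - T)) z.2))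
          ≤ ∫⁻ z in Ioo 0 T ×ˢ (univ : Set (EuclideanSpace ℝ (Fin 3))),
              ENNReal.ofReal (frobeniusNormSq (fderiv ℝ (u (z.1 - T)) z.2)) :=
            lintegral_mono_set (Set.prod_mono Subset.rfl (subset_univ _))
        _ = ∫⁻ z in Ioo (-T) 0 ×ˢ (univ : Set (EuclideanSpace ℝ (Fin 3))),
              ENNReal.ofReal (frobeniusNormSq (fderiv ℝ (u z.1) z.2)) :=
            setLIntegral_prod_shift T univ (fun w => ENNReal.ofReal (frobeniusNormSq (fderiv ℝ (u w.1) w.2)))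
  · -- the datum in `L²_loc`
    intro K' hK'
    have hT2 : 0 < T / 2 := by linarith
    have hsub : Icc 0 (T / 2) ×ˢ (univ : Set (EuclideanSpace ℝ (Fin 3))) ⊆
        (fun z : ℝ × EuclideanSpace ℝ (Fin 3) => (z.1 - T, z.2)) ⁻¹' (Iio 0 ×ˢ univ) := by
      intro z hz
      exact ⟨by have := (mem_prod.1 hz).1.2; show z.1 - T < 0; linarith, mem_univ _⟩
    have hcont : ContinuousOn (uncurry fun t => u (t - T)) (Icc 0 (T / 2) ×ˢ univ) := by
      have h1 : Continuous fun z : ℝ × EuclideanSpace ℝ (Fin 3) => (z.1 - T, z.2) := by fun_prop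
      exact (hu.continuousOn_uncurry.comp h1.continuousOn hsub :)
    have hbd : ∀ t ∈ Icc 0 (T / 2), ∀ x, ‖(fun t => u (t - T)) t x‖ ≤ C / Real.sqrt (T / 2) := by
      intro t ht x
      have h1 : t - T < 0 := by linarith [ht.2]
      refine (hu.norm_le h1 x).trans ?_
      exact div_le_div_of_nonneg_left hu.nonneg (Real.sqrt_pos.2 hT2)
        (Real.sqrt_le_sqrt (by linarith [ht.2]))
    have h := tendsto_lintegral_sub_initial_of_continuousOn hT2 hcont hbd hK'
    simpa only [zero_sub] using h
  · -- (7) decay at spatial infinity through the apex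
    intro R hR
    have h := tendsto_lintegral_slab_ball_cocompact hu hlaw T R
    refine h.congr fun x₀ => ?_
    exact (setLIntegral_prod_shift T (ball x₀ R) (fun w => ‖u w.1 w.2‖ₑ ^ 2)).symm

/-! ### The final-slice leaf -/

/-- **THE FINAL-SLICE LEAF.** A member of the finite-dissipation stratum whose slices tend to `0`
in `𝒟'(ℝ³)` as `t → 0⁻` — `∫ ⟪u(t), φ⟫ → 0` for every smooth compactly supported field `φ` —
vanishes identically on `t < 0`: the shifted field is a local Leray solution on `(0, T) × ℝ³`
vanishing weakly at the final time (`exists_isLocalLeraySolutionOn_shift`), hence `0` a.e. by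
Lemarié-Rieusset's backward uniqueness theorem (Thm. 15.4, the tree's
`IsLocalLeraySolutionOn.ae_zero_of_final_vanishing_unit_anyDatum`), hence everywhere by continuity. -/
theorem eq_zero_of_tendsto_finalSlice (hu : IsTypeIAncientMild C u)
    (hlaw : ∀ s : ℝ, s < 0 → ∫⁻ x, ‖fderiv ℝ (u s) x‖ₑ ^ 2 ≤ ENNReal.ofReal (K / Real.sqrt (-s)))
    (hfinal : ∀ φ : EuclideanSpace ℝ (Fin 3) → EuclideanSpace ℝ (Fin 3),
      FunctionSpaces.IsTestFunctionOn (⊤ : Opens (EuclideanSpace ℝ (Fin 3))) φ →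
        Tendsto (fun t => ∫ x, ⟪u t x, φ x⟫) (𝓝[<] 0) (𝓝 0)) :
    ∀ t < 0, ∀ x, u t x = 0 := by
  intro t ht x
  set T : ℝ := -2 * t with hT
  have hT0 : 0 < T := by rw [hT]; linarith
  obtain ⟨π, hLL⟩ := exists_isLocalLeraySolutionOn_shift hu hlaw hT0
  have hdiv : IsWeaklyDivFree (u (-T)) := hu.isWeaklyDivFree (by linarith)
  -- final vanishing of the shifted field at `t ↑ T`
  have hmap : Tendsto (fun s : ℝ => s - T) (𝓝[<] T) (𝓝[<] 0) := by
    refine tendsto_nhdsWithin_of_tendsto_nhds_of_eventually_within _ ?_ ?_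
    · have h : Tendsto (fun s : ℝ => s - T) (𝓝 T) (𝓝 0) := by
        have h1 := (continuous_sub_right T).tendsto T
        simpa using h1
      exact h.mono_left nhdsWithin_le_nhds
    · filter_upwards [self_mem_nhdsWithin] with s hs
      show s - T < 0
      have hs' : s < T := hs
      linarith
  have hfinal' : ∀ φ : EuclideanSpace ℝ (Fin 3) → EuclideanSpace ℝ (Fin 3),
      FunctionSpaces.IsTestFunctionOn (⊤ : Opens (EuclideanSpace ℝ (Fin 3))) φ →
        Tendsto (fun s => ∫ y, ⟪(fun s => u (s - T)) s y, φ y⟫) (𝓝[<] T) (𝓝 0) :=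
    fun φ hφ => (hfinal φ hφ).comp hmap
  have hae := hLL.ae_zero_of_final_vanishing_unit_anyDatum hT0 hdiv hfinal'
  -- continuity upgrades a.e. to everywhere
  have hsub : Ioo 0 T ×ˢ (univ : Set (EuclideanSpace ℝ (Fin 3))) ⊆
      (fun z : ℝ × EuclideanSpace ℝ (Fin 3) => (z.1 - T, z.2)) ⁻¹' (Iio 0 ×ˢ univ) := by
    intro z hz
    exact ⟨by have := (mem_prod.1 hz).1.2; show z.1 - T < 0; linarith, mem_univ _⟩
  have hcont : ContinuousOn (fun z : ℝ × EuclideanSpace ℝ (Fin 3) => u (z.1 - T) z.2)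
      (Ioo 0 T ×ˢ univ) := by
    have h1 : Continuous fun z : ℝ × EuclideanSpace ℝ (Fin 3) => (z.1 - T, z.2) := by fun_prop
    exact (hu.continuousOn_uncurry.comp h1.continuousOn hsub :)
  have h0 := norm_le_of_ae_le_of_continuousOn (K := 0) (isOpen_Ioo.prod isOpen_univ) hcont
    (hae.mono fun z hz => by
      show ‖u (z.1 - T) z.2‖ ≤ 0
      rw [show u (z.1 - T) z.2 = 0 from hz, norm_zero])
  have hz : ((t + T, x) : ℝ × EuclideanSpace ℝ (Fin 3)) ∈ Ioo 0 T ×ˢ (univ : Set (EuclideanSpace ℝ (Fin 3))) :=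
    ⟨⟨by rw [hT]; linarith, by linarith⟩, mem_univ _⟩
  have h1 := h0 _ hz
  simp only [add_sub_cancel_right] at h1
  exact norm_le_zero_iff.1 h1

/-- **The final-slice leaf, regularity form**: a member of the stratum with vanishing final trace is
bounded at the apex (indeed `≡ 0`). -/
theorem notSingular_of_tendsto_finalSlice (hu : IsTypeIAncientMild C u)
    (hlaw : ∀ s : ℝ, s < 0 → ∫⁻ x, ‖fderiv ℝ (u s) x‖ₑ ^ 2 ≤ ENNReal.ofReal (K / Real.sqrt (-s)))
    (hfinal : ∀ φ : EuclideanSpace ℝ (Fin 3) → EuclideanSpace ℝ (Fin 3),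
      FunctionSpaces.IsTestFunctionOn (⊤ : Opens (EuclideanSpace ℝ (Fin 3))) φ →
        Tendsto (fun t => ∫ x, ⟪u t x, φ x⟫) (𝓝[<] 0) (𝓝 0)) :
    ¬ (∀ r > 0, ∀ M : ℝ, ∃ t ∈ Set.Ioo (-(r ^ 2)) (0 : ℝ),
        ∃ x ∈ Metric.ball (0 : EuclideanSpace ℝ (Fin 3)) r, M < ‖u t x‖) := by
  intro hsing
  obtain ⟨t, ht, x, -, hM⟩ := hsing 1 one_pos 0
  rw [eq_zero_of_tendsto_finalSlice hu hlaw hfinal t ht.2 x, norm_zero] at hM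
  exact lt_irrefl _ hM

/-- **PORTRAIT ENTRY (both stubs): a singular member of the stratum leaves a nonzero distributional
trace at the singular time** — some test field `φ` has `∫ ⟪u(t), φ⟫ ↛ 0` as `t → 0⁻`. Applies to the
past-DSS members (the trace is the homogeneous final datum) AND to the past-wandering recurrent
members of `stub_pastWanderingRecurrentLiouville`. -/
theorem exists_test_not_tendsto_of_singular (hu : IsTypeIAncientMild C u)
    (hlaw : ∀ s : ℝ, s < 0 → ∫⁻ x, ‖fderiv ℝ (u s) x‖ₑ ^ 2 ≤ ENNReal.ofReal (K / Real.sqrt (-s)))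
    (hsing : ∀ r > 0, ∀ M : ℝ, ∃ t ∈ Set.Ioo (-(r ^ 2)) (0 : ℝ),
      ∃ x ∈ Metric.ball (0 : EuclideanSpace ℝ (Fin 3)) r, M < ‖u t x‖) :
    ∃ φ : EuclideanSpace ℝ (Fin 3) → EuclideanSpace ℝ (Fin 3),
      FunctionSpaces.IsTestFunctionOn (⊤ : Opens (EuclideanSpace ℝ (Fin 3))) φ ∧
        ¬ Tendsto (fun t => ∫ x, ⟪u t x, φ x⟫) (𝓝[<] 0) (𝓝 0) := by
  by_contra h
  push Not at h
  exact notSingular_of_tendsto_finalSlice hu hlaw h hsing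

/-! ### Bookkeeping: the crux lives on members with nonzero final trace -/

/-- **The crux is equivalent to its restriction to members with NONZERO final trace** (members with
vanishing trace are `≡ 0` by the final-slice leaf). -/
theorem finiteDissipationLiouville_iff_nonzeroTrace :
    Theses.LerayQuarterDissipation.FiniteDissipationLiouville ↔
      ∀ (C K : ℝ) (ū : ℝ → EuclideanSpace ℝ (Fin 3) → EuclideanSpace ℝ (Fin 3)),
        IsTypeIAncientMild C ū →
        (∀ s : ℝ, s < 0 → ∫⁻ x, ‖fderiv ℝ (ū s) x‖ₑ ^ 2 ≤ ENNReal.ofReal (K / Real.sqrt (-s))) →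
        (∃ φ : EuclideanSpace ℝ (Fin 3) → EuclideanSpace ℝ (Fin 3),
          FunctionSpaces.IsTestFunctionOn (⊤ : Opens (EuclideanSpace ℝ (Fin 3))) φ ∧
            ¬ Tendsto (fun t => ∫ x, ⟪ū t x, φ x⟫) (𝓝[<] 0) (𝓝 0)) →
        ¬ (∀ r > 0, ∀ M : ℝ, ∃ t ∈ Set.Ioo (-(r ^ 2)) (0 : ℝ),
            ∃ x ∈ Metric.ball (0 : EuclideanSpace ℝ (Fin 3)) r, M < ‖ū t x‖) := by
  constructor
  · intro h C K ū hū hD _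
    exact h C K ū hū hD
  · intro h C K ū hū hD hsing
    exact h C K ū hū hD (exists_test_not_tendsto_of_singular hū hD hsing) hsing

end Summit.NavierStokesRegularity.NavierStokesRegularity.Theorems.FiniteDissipationLiouville.Birth.Apex

end
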